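import Literature.NumberTheory.Automorphic.FixedCosetsStableLattices        -- ★ (D4½): `span_range_transpose_mul`, `glInt`, `formCongr`
import Literature.NumberTheory.Automorphic.UnitaryConjClassClosed           -- ★ `formCongr_mul`
import Literature.NumberTheory.Automorphic.UnitaryGroupFormTransport         -- ★ `formCongr_inv_formCongr`
import HarnessLib

/-!
# Frame transport for the count of `γ`-stable self-dual lattices: `#S(J, γ) = #S(ᵗσ(P) J P, P⁻¹ γ P)`, and diagonal rescaling of an eigenframe
(Kottwitz 1986 §3; Laumon 1996 (4.3.11); Rogawski 1990 §4.9 Lemma 4.9.3)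

Topic `NumberTheory/Automorphic`; namespace `Literature.NumberTheory.Automorphic`.  THEOREMS ONLY (no definition, no instance, no notation, no named fact, no `sorry`;
count-neutral for the books).  Cell `pub/hodgecm-mathlib`, F0∕P3a road «D-N7-inert», brick **(L5-d1) «FRAME TRANSPORT»** of the H-side count (L5)∕(F9) [Flicker1998UnitaryFL
§6 p. 95] (B-p10 (g24) integrator, owner table 2026-09-01T03:45:13Z; LEAD F0P3a-plan (g9) T8-35 (C)∕T8-42∕T8-43): the bridge from the lattice-count SOCKET ★
`UnitaryUnitOrbitalIntegralLatticeCount` (`Φ(⟦γ⟧, 1_{K_v}) = #S(H_w, γ_w)`) to the NORMALISED count of (L5-b) (B-p04 (g33): `J = ϖ^e • 1`, `γ = diag(a, c)`).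
HONEST LABEL: HC_CM is proved only modulo the printed citations until rung 0 closes; nothing printed is a letter here — elementary change of basis.

THE SET.  For a field `F` with a valuative relation (`𝒪 = 𝒪[F]`), `σ : F →+* F`, `J ∈ M_n(F)`, `γ ∈ GL_n(F)`, the socket's set is written INLINE (no definition):
`S(J, γ) = {Λ ⊂ Fⁿ an 𝒪-submodule | (∃ g ∈ GL_n(F), ᵗσ(g) J g ∈ GL_n(𝒪) ∧ Λ = Λ(g)) ∧ γ Λ = Λ}`, `Λ(g) = span_𝒪 (columns of g)` (★ (D4½) currency
`Submodule.span 𝒪[F] (Set.range (↑g)ᵀ)`, self-duality token `∃ J′ ∈ glInt n F, ↑J′ = formCongr σ g J`, stability `Λ.map (toLin' ↑γ) = Λ`).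
* §1 TRANSPORT (any `F`, `σ`, `n`, `P ∈ GL_n(F)`): `Λ ↦ P⁻¹ Λ` maps `S(J, γ)` onto `S(ᵗσ(P) J P, P⁻¹ γ P)` (`image_map_inv_selfDualStable_eq`; `Λ(g) ↦ Λ(P⁻¹ g)`,
  `ᵗσ(P⁻¹g) (ᵗσ(P) J P) (P⁻¹ g) = ᵗσ(g) J g`, ★ `formCongr_mul`), injectively, hence **`ncard_selfDualStable_congr`**: `#S(J, γ) = #S(formCongr σ P J, P⁻¹ γ P)`.
* §2 DIAGONAL FRAMES: `formCongr σ (P · diag c) J = diag(σ(cᵢ) dᵢ cᵢ)` when `formCongr σ P J = diag(d)` (`formCongr_mul_diagonal_of_eq_diagonal`), so a column rescaling with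
  `σ(cᵢ) dᵢ cᵢ = t` makes the transported form the SCALAR `t • 1` (`formCongr_mul_diagonal_eq_smul_one`); and an eigenframe `γ P = P · diag(u)` stays one,
  `(P · diag c)⁻¹ γ (P · diag c) = diag(u)` (`inv_mul_mul_eq_diagonal_of_eigenframe`) — the transported `γ` IS the diagonal `!![u₀, 0; 0, u₁]` of (L5-b).
* §3 the combination **`ncard_selfDualStable_eq_of_eigenframe_of_rescaling`**: given an eigenframe `P` with `formCongr σ P J = diag(d)` and scalars `c` with
  `σ(cᵢ) dᵢ cᵢ = t`, `#S(J, γ) = #S(t • 1, diag(u))`.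
The ARITHMETIC of the rescaling at an unramified non-split place (`t = ϖ^e`, `e ∈ {0,1}`: even powers are norms `N(ϖ^k)`, `σ`-fixed units are norms, ★
`QuadraticLocalUnramifiedUnitNorm`) and the parity flip between the two classes of ★ `LocalStableClassesNonsplitRankTwo` are the sequel (L5-d1)′ on the CM carriers.

## References
* [Kottwitz1986] R. E. Kottwitz, *Base change for unit elements of Hecke algebras*, Compositio Math. 60 (1986), §3.
* [Laumon1995] G. Laumon, *Cohomology of Drinfeld Modular Varieties* I (1996), (4.3.11) p. 83.
* [Rogawski1990] J. D. Rogawski, *Automorphic Representations of Unitary Groups in Three Variables*, Ann. of Math. Stud. 123 (1990), §4.9 Lemma 4.9.3 p. 56.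
* [Flicker1998UnitaryFL] Y. Z. Flicker, *Elementary proof of the fundamental lemma for a unitary group*, Canad. J. Math. 50 (1998), §6 p. 95.
-/

set_option autoImplicit false

noncomputable section

open scoped ValuativeRel Matrix MatrixGroups
open Set Matrix

namespace Literature.NumberTheory.Automorphic

variable {F : Type*} [Field F] [ValuativeRel F] {n : ℕ} (σ : F →+* F)

/-! ## §1 Transport of the self-dual stable lattices along a change of basis -/

section Transport

omit [ValuativeRel F] in
/-- Conjugating the stability condition: `(P⁻¹ g)⁻¹ (P⁻¹ γ P) (P⁻¹ g) = g⁻¹ γ g`. [folklore] -/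
private theorem inv_mul_conj_mul (P γ g : GL (Fin n) F) : (P⁻¹ * g)⁻¹ * (P⁻¹ * γ * P) * (P⁻¹ * g) = g⁻¹ * γ * g := by
  group

omit [ValuativeRel F] in
/-- The self-duality token is invariant under the frame change: `ᵗσ(P⁻¹ g) (ᵗσ(P) J P) (P⁻¹ g) = ᵗσ(g) J g` (★ `formCongr_mul`). [cite: Kottwitz1986, §3] -/
theorem formCongr_inv_mul_formCongr (P g : GL (Fin n) F) (J : Matrix (Fin n) (Fin n) F) :
    formCongr σ (P⁻¹ * g) (formCongr σ P J) = formCongr σ g J := by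
  rw [← formCongr_mul, mul_inv_cancel_left]

/-- **`P⁻¹ · S(J, γ) = S(ᵗσ(P) J P, P⁻¹ γ P)`**: the image of the set of `γ`-stable `J`-self-dual lattices under `Λ ↦ P⁻¹Λ` is the set of `P⁻¹γP`-stable
`ᵗσ(P)JP`-self-dual lattices (`Λ(g) ↦ Λ(P⁻¹ g)`, ★ `span_range_transpose_mul`; stability read as `g⁻¹ γ g ∈ GL_n(𝒪)`, ★ `map_span_range_transpose_eq_self_iff`).
[cite: Kottwitz1986, §3] [cite: Laumon1995, (4.3.11) p. 83] -/
theorem image_map_inv_selfDualStable_eq (J : Matrix (Fin n) (Fin n) F) (γ P : GL (Fin n) F) :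
    (fun Λ : Submodule 𝒪[F] (Fin n → F) => Λ.map ((Matrix.toLin' ((P⁻¹ : GL (Fin n) F) : Matrix (Fin n) (Fin n) F)).restrictScalars 𝒪[F])) ''
        {Λ : Submodule 𝒪[F] (Fin n → F) |
          (∃ g : GL (Fin n) F, (∃ J' ∈ glInt n F, (J' : Matrix (Fin n) (Fin n) F) = formCongr σ g J) ∧
            Λ = Submodule.span 𝒪[F] (Set.range ((g : Matrix (Fin n) (Fin n) F))ᵀ)) ∧
          Λ.map ((Matrix.toLin' ((γ : GL (Fin n) F) : Matrix (Fin n) (Fin n) F)).restrictScalars 𝒪[F]) = Λ} =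
      {Λ : Submodule 𝒪[F] (Fin n → F) |
        (∃ g : GL (Fin n) F, (∃ J' ∈ glInt n F, (J' : Matrix (Fin n) (Fin n) F) = formCongr σ g (formCongr σ P J)) ∧
          Λ = Submodule.span 𝒪[F] (Set.range ((g : Matrix (Fin n) (Fin n) F))ᵀ)) ∧
        Λ.map ((Matrix.toLin' (((P⁻¹ * γ * P : GL (Fin n) F)) : Matrix (Fin n) (Fin n) F)).restrictScalars 𝒪[F]) = Λ} := by
  ext Λ'
  simp only [Set.mem_image, Set.mem_setOf_eq]
  constructor
  · rintro ⟨Λ, ⟨⟨g, hsd, rfl⟩, hstab⟩, rfl⟩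
    refine ⟨⟨P⁻¹ * g, ?_, ?_⟩, ?_⟩
    · rwa [formCongr_inv_mul_formCongr]
    · rw [Units.val_mul, span_range_transpose_mul]
    · rw [← span_range_transpose_mul, ← Units.val_mul, map_span_range_transpose_eq_self_iff, inv_mul_conj_mul,
        ← map_span_range_transpose_eq_self_iff]
      exact hstab
  · rintro ⟨⟨h, hsd, rfl⟩, hstab⟩
    refine ⟨Submodule.span 𝒪[F] (Set.range (((P * h : GL (Fin n) F)) : Matrix (Fin n) (Fin n) F)ᵀ), ⟨⟨P * h, ?_, rfl⟩, ?_⟩, ?_⟩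
    · rwa [← formCongr_inv_mul_formCongr σ P (P * h), inv_mul_cancel_left]
    · rw [map_span_range_transpose_eq_self_iff]
      rw [map_span_range_transpose_eq_self_iff] at hstab
      have e : (P * h)⁻¹ * γ * (P * h) = h⁻¹ * (P⁻¹ * γ * P) * h := by group
      rwa [e]
    · rw [← span_range_transpose_mul, ← Units.val_mul, inv_mul_cancel_left]

/-- **FRAME TRANSPORT OF THE COUNT: `#S(J, γ) = #S(ᵗσ(P) J P, P⁻¹ γ P)`** for every `P ∈ GL_n(F)` — `Λ ↦ P⁻¹Λ` is injective on `𝒪`-submodules (`P⁻¹` is a linear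
automorphism) and maps the one set onto the other (`image_map_inv_selfDualStable_eq`).  The number of `γ`-stable self-dual lattices is a function of the pair
`(form, element)` up to simultaneous change of basis. [cite: Kottwitz1986, §3] [cite: Rogawski1990, §4.9 Lemma 4.9.3 p. 56] -/
theorem ncard_selfDualStable_congr (J : Matrix (Fin n) (Fin n) F) (γ P : GL (Fin n) F) :
    {Λ : Submodule 𝒪[F] (Fin n → F) |
        (∃ g : GL (Fin n) F, (∃ J' ∈ glInt n F, (J' : Matrix (Fin n) (Fin n) F) = formCongr σ g J) ∧
          Λ = Submodule.span 𝒪[F] (Set.range ((g : Matrix (Fin n) (Fin n) F))ᵀ)) ∧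
        Λ.map ((Matrix.toLin' ((γ : GL (Fin n) F) : Matrix (Fin n) (Fin n) F)).restrictScalars 𝒪[F]) = Λ}.ncard =
      {Λ : Submodule 𝒪[F] (Fin n → F) |
        (∃ g : GL (Fin n) F, (∃ J' ∈ glInt n F, (J' : Matrix (Fin n) (Fin n) F) = formCongr σ g (formCongr σ P J)) ∧
          Λ = Submodule.span 𝒪[F] (Set.range ((g : Matrix (Fin n) (Fin n) F))ᵀ)) ∧
        Λ.map ((Matrix.toLin' (((P⁻¹ * γ * P : GL (Fin n) F)) : Matrix (Fin n) (Fin n) F)).restrictScalars 𝒪[F]) = Λ}.ncard := by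
  rw [← image_map_inv_selfDualStable_eq σ J γ P, Set.ncard_image_of_injective]
  -- `Λ ↦ P⁻¹ Λ` is injective: `P⁻¹` acts by a linear equivalence
  intro Λ₁ Λ₂ h
  have key : ∀ Λ : Submodule 𝒪[F] (Fin n → F),
      (Λ.map ((Matrix.toLin' ((P⁻¹ : GL (Fin n) F) : Matrix (Fin n) (Fin n) F)).restrictScalars 𝒪[F])).map
        ((Matrix.toLin' ((P : GL (Fin n) F) : Matrix (Fin n) (Fin n) F)).restrictScalars 𝒪[F]) = Λ := by
    intro Λ
    have hcomp : ((Matrix.toLin' ((P : GL (Fin n) F) : Matrix (Fin n) (Fin n) F)).restrictScalars 𝒪[F]).comp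
        ((Matrix.toLin' ((P⁻¹ : GL (Fin n) F) : Matrix (Fin n) (Fin n) F)).restrictScalars 𝒪[F]) = LinearMap.id := by
      apply LinearMap.ext
      intro x
      simp only [LinearMap.comp_apply, LinearMap.restrictScalars_apply, Matrix.toLin'_apply, LinearMap.id_apply, Matrix.mulVec_mulVec,
        ← Units.val_mul, mul_inv_cancel, Units.val_one, Matrix.one_mulVec]
    rw [← Submodule.map_comp, hcomp, Submodule.map_id]
  have h' := congrArg (fun Λ : Submodule 𝒪[F] (Fin n → F) =>
    Λ.map ((Matrix.toLin' ((P : GL (Fin n) F) : Matrix (Fin n) (Fin n) F)).restrictScalars 𝒪[F])) h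
  simp only [key] at h'
  exact h'

end Transport

/-! ## §2 Diagonal frames: rescaling the columns of an eigenframe -/

section Diagonal

omit [ValuativeRel F] in
/-- **`formCongr σ (P · diag c) J = diag(σ(cᵢ) dᵢ cᵢ)`** when the form in the frame `P` is diagonal, `formCongr σ P J = diag(d)` (★ `formCongr_mul`; diagonal times
diagonal). [cite: Rogawski1990, §3.5 p. 29] -/
theorem formCongr_mul_diagonal_of_eq_diagonal (P D : GL (Fin n) F) (J : Matrix (Fin n) (Fin n) F) {d c : Fin n → F}
    (hP : formCongr σ P J = diagonal d) (hD : (D : Matrix (Fin n) (Fin n) F) = diagonal c) :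
    formCongr σ (P * D) J = diagonal fun i => σ (c i) * d i * c i := by
  rw [formCongr_mul, hP]
  change ((D : Matrix (Fin n) (Fin n) F).map σ)ᵀ * diagonal d * (D : Matrix (Fin n) (Fin n) F) = _
  rw [hD, diagonal_map (map_zero σ), diagonal_transpose, diagonal_mul_diagonal, diagonal_mul_diagonal]

omit [ValuativeRel F] in
/-- **Rescaling to a scalar form**: if `formCongr σ P J = diag(d)` and `σ(cᵢ) dᵢ cᵢ = t` for every `i`, then `formCongr σ (P · diag c) J = t • 1`.
[cite: Rogawski1990, §3.5 p. 29] [cite: Flicker1998UnitaryFL, §6 p. 95] -/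
theorem formCongr_mul_diagonal_eq_smul_one (P D : GL (Fin n) F) (J : Matrix (Fin n) (Fin n) F) {d c : Fin n → F} {t : F}
    (hP : formCongr σ P J = diagonal d) (hD : (D : Matrix (Fin n) (Fin n) F) = diagonal c) (hc : ∀ i, σ (c i) * d i * c i = t) :
    formCongr σ (P * D) J = t • (1 : Matrix (Fin n) (Fin n) F) := by
  rw [formCongr_mul_diagonal_of_eq_diagonal σ P D J hP hD]
  have e : (fun i => σ (c i) * d i * c i) = fun _ => t := funext hc
  rw [e, ← Matrix.smul_one_eq_diagonal]

omit [ValuativeRel F] in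
/-- **A rescaled eigenframe is an eigenframe with the SAME diagonal**: `γ P = P · diag(u)` ⟹ `(P · diag c)⁻¹ γ (P · diag c) = diag(u)` (diagonal matrices commute).
[cite: Rogawski1990, §3.5 p. 29] -/
theorem inv_mul_mul_eq_diagonal_of_eigenframe (γ P D : GL (Fin n) F) {u c : Fin n → F}
    (hP : (γ : Matrix (Fin n) (Fin n) F) * P = P * diagonal u) (hD : (D : Matrix (Fin n) (Fin n) F) = diagonal c) :
    (((P * D)⁻¹ * γ * (P * D) : GL (Fin n) F) : Matrix (Fin n) (Fin n) F) = diagonal u := by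
  have hPD : (γ : Matrix (Fin n) (Fin n) F) * ((P * D : GL (Fin n) F) : Matrix (Fin n) (Fin n) F) =
      ((P * D : GL (Fin n) F) : Matrix (Fin n) (Fin n) F) * diagonal u := by
    rw [Units.val_mul, ← Matrix.mul_assoc, hP, Matrix.mul_assoc, Matrix.mul_assoc, hD, diagonal_mul_diagonal, diagonal_mul_diagonal]
    congr 2
    funext i
    exact mul_comm _ _
  rw [Units.val_mul, Units.val_mul, Matrix.mul_assoc, hPD, ← Matrix.mul_assoc, ← Units.val_mul, inv_mul_cancel, Units.val_one, Matrix.one_mul]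

end Diagonal

/-! ## §3 The combination: transport to the normalised pair `(t • 1, diag u)` -/

section Combination

/-- **`#S(J, γ) = #S(t • 1, diag u)`** for `γ` with an eigenframe `γ P = P · diag(u)` in which the form is diagonal, `formCongr σ P J = diag(d)`, and column scalars
`c` (units) with `σ(cᵢ) dᵢ cᵢ = t`: §1 at the frame `P · diag(c)`, whose transported form is `t • 1` and transported element `diag(u)` (§2).  This is the shape in
which the normalised lattice count (form `ϖ^e • 1`, element `!![u₀, 0; 0, u₁]`) is consumed. [cite: Kottwitz1986, §3] [cite: Flicker1998UnitaryFL, §6 p. 95] -/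
theorem ncard_selfDualStable_eq_of_eigenframe_of_rescaling (J : Matrix (Fin n) (Fin n) F) (γ P D : GL (Fin n) F) {u d c : Fin n → F} {t : F}
    (hP : (γ : Matrix (Fin n) (Fin n) F) * P = P * diagonal u) (hd : formCongr σ P J = diagonal d)
    (hD : (D : Matrix (Fin n) (Fin n) F) = diagonal c) (hc : ∀ i, σ (c i) * d i * c i = t) :
    {Λ : Submodule 𝒪[F] (Fin n → F) |
        (∃ g : GL (Fin n) F, (∃ J' ∈ glInt n F, (J' : Matrix (Fin n) (Fin n) F) = formCongr σ g J) ∧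
          Λ = Submodule.span 𝒪[F] (Set.range ((g : Matrix (Fin n) (Fin n) F))ᵀ)) ∧
        Λ.map ((Matrix.toLin' ((γ : GL (Fin n) F) : Matrix (Fin n) (Fin n) F)).restrictScalars 𝒪[F]) = Λ}.ncard =
      {Λ : Submodule 𝒪[F] (Fin n → F) |
        (∃ g : GL (Fin n) F, (∃ J' ∈ glInt n F, (J' : Matrix (Fin n) (Fin n) F) = formCongr σ g (t • (1 : Matrix (Fin n) (Fin n) F))) ∧
          Λ = Submodule.span 𝒪[F] (Set.range ((g : Matrix (Fin n) (Fin n) F))ᵀ)) ∧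
        Λ.map ((Matrix.toLin' (diagonal u)).restrictScalars 𝒪[F]) = Λ}.ncard := by
  rw [ncard_selfDualStable_congr σ J γ (P * D), formCongr_mul_diagonal_eq_smul_one σ P D J hd hD hc,
    inv_mul_mul_eq_diagonal_of_eigenframe γ P D hP hD]

end Combination

end Literature.NumberTheory.Automorphic

end
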